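import Mathlib
import HarnessLib
import Literature.Analysis.FluidPDE.ClassicalLerayProjection
import Literature.Analysis.FluidPDE.NewtonKernel
import Summits.NavierStokesRegularity.NavierStokesRegularity.Theorems.QuarterLogPincerQuietCollarLerayData
import Summits.NavierStokesRegularity.NavierStokesRegularity.Theorems.QuarterLogPincerQuietCollarDataSurgery

/-!
# Route `QuarterLogPincer`, crux `TypeIQuantSubcubicExp` (stmt-NavierStokesRegularity-24077), line `quiet_collar` — towards QP2
# (log-weighted typing `StubCutPairLog`), module D: THE DATUM OF THE CUT PAIR

Assembly of D1 (`…QuietCollarLerayData`: the Leray-projected cut slice and the bounds of its data error `∇π[χa]`) and D3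
(`…QuietCollarDataSurgery`: compact-support surgery with a Bogovskiĭ corrector) into THE DATUM `u₀` of `CutPairLog`:

* `exists_cutPair_datum` — for a smooth divergence-free `a` (= `v(−1)`), `η`-quiet on the collar `{r ≤ |x| ≤ r+L}` (`r ≥ 2`,
  `L ≥ 1`), and a radius factor `Λ ≥ 1`: a smooth, divergence-free, compactly supported `u₀`, vanishing off
  `B̄(0, 2Λ(r+L)²)`, with `‖u₀(x) − χ(x)a(x)‖ ≤ C·η·(1 + log r)` at every `x` (`χ = radialCutoff r (r+L)`) and
  `‖u₀ − χa‖_{L³} ≤ C_R‖1_{B(0,r+L)}a‖_{L³} + C·η` — the constants `C`, `C_R` are ABSOLUTE (no `r`, `L`, `Λ`, `η`).  With the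
  log-weighted collar level `η = ηq/(1+log r)` the sup error is `≤ C·ηq`, uniformly in the radius.

Construction: `P = P[χa]` (tree `classicalLerayProj`), `R₀ = Λ(r+L)² ≥ 2(r+L)`, far size `D = C_far·η(r+L)²/R₀²`
(`exists_norm_gradient_divPotential_cutRef_far_le`), surgery `u₀ = λP − W` at `R₀` (`exists_divFree_compactSupport_surgery`);
`u₀ − χa = (u₀ − λP) − λ∇π[χa]` because `λχ = χ`.  HONEST FRAME: a construction about a hypothetical field; nothing here bears on
24077, W7 or Navier–Stokes regularity (OPEN).  pub-ns-dss typer (g37), `--supports 24077`.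
-/

noncomputable section

set_option linter.dupNamespace false

namespace Summit.NavierStokesRegularity.NavierStokesRegularity.Cruxes.TypeIQuantSubcubicExp.QuietCollar

open MeasureTheory Set Function Filter Real Metric
open scoped ENNReal NNReal Topology
open Literature.Analysis Literature.Analysis.FluidPDE Literature.Analysis.FluidPDE.CalderonSplittingLp

/-- **THE DATUM OF THE CUT PAIR**: there are absolute constants `C > 0`, `C_R` such that for every smooth divergence-free `a`,
`η`-quiet on the collar `{r ≤ |x| ≤ r+L}` (`2 ≤ r`, `1 ≤ L`, `0 ≤ η`), and every `Λ ≥ 1`, there is `u₀ : ℝ³ → ℝ³` smooth,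
divergence-free, compactly supported, vanishing off `B̄(0,2Λ(r+L)²)`, with
`‖u₀(x) − χ(x)a(x)‖ ≤ C·η·(1 + log r)` for all `x` and `‖u₀ − χa‖_{L³} ≤ C_R‖1_{B(0,r+L)}a‖_{L³} + C·η`
(`χ = radialCutoff r (r+L)`). [folklore] -/
theorem exists_cutPair_datum :
    ∃ (C : ℝ) (CR : ℝ≥0), 0 < C ∧ ∀ (a : EuclideanSpace ℝ (Fin 3) → EuclideanSpace ℝ (Fin 3)) (r L η Λ : ℝ),
      ContDiff ℝ (⊤ : ℕ∞) a → VectorCalculus.IsDivFree a → 2 ≤ r → 1 ≤ L → 0 ≤ η → 1 ≤ Λ →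
      (∀ t, r ≤ ‖t‖ → ‖t‖ ≤ r + L → ‖a t‖ ≤ η) →
      ∃ u₀ : EuclideanSpace ℝ (Fin 3) → EuclideanSpace ℝ (Fin 3),
        ContDiff ℝ (⊤ : ℕ∞) u₀ ∧ VectorCalculus.IsDivFree u₀ ∧ HasCompactSupport u₀ ∧
        (∀ x, u₀ x ≠ 0 → ‖x‖ ≤ 2 * (Λ * (r + L) ^ 2)) ∧
        (∀ x, ‖u₀ x - radialCutoff r (r + L) x • a x‖ ≤ C * η * (1 + Real.log r)) ∧
        eLpNorm (fun x => u₀ x - radialCutoff r (r + L) x • a x) 3 volume ≤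
          CR * eLpNorm ((Metric.ball (0 : EuclideanSpace ℝ (Fin 3)) (r + L)).indicator a) 3 volume + ENNReal.ofReal (C * η) := by
  obtain ⟨Clog, hClog, hlog⟩ := exists_norm_gradient_divPotential_cutRef_le_log
  obtain ⟨Cfar, hCfar, hfar⟩ := exists_norm_gradient_divPotential_cutRef_far_le
  obtain ⟨CR, hR⟩ := exists_eLpNorm_gradient_divPotential_cutRef_le
  obtain ⟨CS, hCS, hsurg⟩ := exists_divFree_compactSupport_surgery
  -- the volume constant `|B̄(0,1)|^{1/3}·2`-type factor: `|B̄(0,2R₀)| = (2R₀)³|B̄(0,1)|`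
  set V₁ : ℝ≥0∞ := volume (Metric.ball (0 : EuclideanSpace ℝ (Fin 3)) 1) with hV₁
  have hV₁top : V₁ ≠ ⊤ := measure_ball_lt_top.ne
  set v₁ : ℝ := (V₁ ^ (1 / (3 : ℝ))).toReal with hv₁
  have hv₁0 : 0 ≤ v₁ := ENNReal.toReal_nonneg
  refine ⟨Clog + CS * Cfar * (1 + 2 * v₁), CR, by positivity, ?_⟩
  intro a r L η Λ ha hdiv hr hL hη hΛ hquiet
  have hr0 : 0 < r := by linarith
  have hL0 : 0 < L := by linarith
  have hrL : 2 ≤ r + L := by linarith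
  have hρ : 0 < r + L := by linarith
  have hlogr : 0 ≤ Real.log r := Real.log_nonneg (by linarith)
  set χ : EuclideanSpace ℝ (Fin 3) → ℝ := radialCutoff r (r + L) with hχ
  set R₀ : ℝ := Λ * (r + L) ^ 2 with hR₀
  have hR₀ge : 2 * (r + L) ≤ R₀ := by
    rw [hR₀]
    have : 2 * (r + L) ≤ 1 * (r + L) ^ 2 := by nlinarith
    calc 2 * (r + L) ≤ 1 * (r + L) ^ 2 := this
      _ ≤ Λ * (r + L) ^ 2 := mul_le_mul_of_nonneg_right hΛ (by positivity)
  have hR₀pos : 0 < R₀ := by linarith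
  have hrLR₀ : r + L ≤ R₀ := by linarith
  -- the cut slice and its Leray projection
  have hG : ContDiff ℝ (⊤ : ℕ∞) (fun y => χ y • a y) := (radialCutoff_contDiff r (r + L)).smul ha
  have hGc : HasCompactSupport (fun y => χ y • a y) := (hasCompactSupport_radialCutoff hr0.le (by linarith)).smul_right
  set P : EuclideanSpace ℝ (Fin 3) → EuclideanSpace ℝ (Fin 3) := classicalLerayProj (fun y => χ y • a y) with hP
  have hPs : ContDiff ℝ (⊤ : ℕ∞) P := contDiff_classicalLerayProj hG hGc
  have hPdiv : VectorCalculus.IsDivFree P := isDivFree_classicalLerayProj hG hGc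
  set gπ : EuclideanSpace ℝ (Fin 3) → EuclideanSpace ℝ (Fin 3) := fun x => gradient (divPotential fun y => χ y • a y) x with hgπ
  have hP_eq : ∀ x, P x = χ x • a x - gπ x := fun x => rfl
  -- the far size of `P` beyond `R₀`
  set D : ℝ := Cfar * η * (r + L) ^ 2 / R₀ ^ 2 with hD
  have hD0 : 0 ≤ D := by positivity
  have hPfar : ∀ x, R₀ ≤ ‖x‖ → ‖P x‖ ≤ D := by
    intro x hx
    have hx2 : 2 * (r + L) ≤ ‖x‖ := hR₀ge.trans hx
    have hxpos : 0 < ‖x‖ := by linarith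
    rw [hP, classicalLerayProj_cutRef_eq_neg_gradient hr0.le hL0 (hrLR₀.trans hx), norm_neg]
    refine (hfar a r L η ha hdiv hr0 hL0 hη hquiet x hx2).trans ?_
    rw [hD]
    have h1 : ‖x‖ ^ 2 ≥ R₀ ^ 2 := by gcongr
    exact div_le_div_of_nonneg_left (by positivity) (by positivity) h1
  -- the surgery
  obtain ⟨u₀, hu₀s, hu₀d, hu₀c, hu₀supp, hu₀near, hu₀corr⟩ := hsurg P R₀ D hPs hPdiv hR₀pos hD0 hPfar
  -- `λχ = χ`
  have hlamχ : ∀ x, radialCutoff R₀ (2 * R₀) x • P x - χ x • a x = (u₀ x - χ x • a x) - (u₀ x - radialCutoff R₀ (2 * R₀) x • P x) := by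
    intro x; abel
  have hkey : ∀ x, radialCutoff R₀ (2 * R₀) x • P x - χ x • a x = -(radialCutoff R₀ (2 * R₀) x • gπ x) := by
    intro x
    rw [hP_eq, smul_sub]
    by_cases hx : ‖x‖ ≤ R₀
    · rw [radialCutoff_eq_one hR₀pos.le (by linarith) hx, one_smul, one_smul]; abel
    · have hχ0 : χ x = 0 := by
        rw [hχ]; exact radialCutoff_eq_zero hr0.le (by linarith) (le_of_lt (lt_of_le_of_lt hrLR₀ (not_le.1 hx)))
      rw [hχ0, zero_smul, smul_zero, zero_sub, sub_zero]
  have hdiff : ∀ x, u₀ x - χ x • a x = (u₀ x - radialCutoff R₀ (2 * R₀) x • P x) - radialCutoff R₀ (2 * R₀) x • gπ x := by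
    intro x
    have := hkey x
    calc u₀ x - χ x • a x = (u₀ x - radialCutoff R₀ (2 * R₀) x • P x) + (radialCutoff R₀ (2 * R₀) x • P x - χ x • a x) := by abel
      _ = _ := by rw [this]; abel
  -- sup bounds
  have hgπ_sup : ∀ x, ‖gπ x‖ ≤ Clog * η * (1 + Real.log r) := fun x =>
    hlog a r L η ha hdiv (by linarith) hL hη hquiet x
  have hD_le : CS * D ≤ CS * Cfar * η := by
    rw [hD]
    have h1 : (r + L) ^ 2 / R₀ ^ 2 ≤ 1 := by
      rw [div_le_one (by positivity)]
      calc (r + L) ^ 2 = 1 * (r + L) ^ 2 := (one_mul _).symm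
        _ ≤ R₀ * R₀ := by
            rw [hR₀]
            have h2 : 1 ≤ Λ * (r + L) ^ 2 := by nlinarith
            nlinarith
        _ = R₀ ^ 2 := (sq R₀).symm
    calc CS * (Cfar * η * (r + L) ^ 2 / R₀ ^ 2) = CS * Cfar * η * ((r + L) ^ 2 / R₀ ^ 2) := by ring
      _ ≤ CS * Cfar * η * 1 := mul_le_mul_of_nonneg_left h1 (by positivity)
      _ = CS * Cfar * η := mul_one _
  refine ⟨u₀, hu₀s, hu₀d, hu₀c, ?_, fun x => ?_, ?_⟩
  · intro x hx; rw [hR₀] at hu₀supp; exact hu₀supp x hx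
  · rw [hdiff x]
    have hlam1 : |radialCutoff R₀ (2 * R₀) x| ≤ 1 := by
      rw [abs_of_nonneg (radialCutoff_nonneg _ _ _)]; exact radialCutoff_le_one _ _ _
    calc ‖(u₀ x - radialCutoff R₀ (2 * R₀) x • P x) - radialCutoff R₀ (2 * R₀) x • gπ x‖
        ≤ ‖u₀ x - radialCutoff R₀ (2 * R₀) x • P x‖ + ‖radialCutoff R₀ (2 * R₀) x • gπ x‖ := norm_sub_le _ _
      _ ≤ CS * D + 1 * (Clog * η * (1 + Real.log r)) := by
          refine add_le_add (hu₀near x) ?_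
          rw [norm_smul, Real.norm_eq_abs]
          exact mul_le_mul hlam1 (hgπ_sup x) (norm_nonneg _) zero_le_one
      _ ≤ CS * Cfar * η * (1 + Real.log r) + Clog * η * (1 + Real.log r) := by
          have h1 : CS * D ≤ CS * Cfar * η * (1 + Real.log r) := by
            calc CS * D ≤ CS * Cfar * η := hD_le
              _ = CS * Cfar * η * 1 := (mul_one _).symm
              _ ≤ CS * Cfar * η * (1 + Real.log r) := by gcongr; linarith
          linarith
      _ ≤ (Clog + CS * Cfar * (1 + 2 * v₁)) * η * (1 + Real.log r) := by
          have : 0 ≤ CS * Cfar * (2 * v₁) * η * (1 + Real.log r) := by positivity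
          nlinarith
  · -- the `L³` bound: corrector (bounded, supported in `B̄(0,2R₀)`) + `λ∇π` (Riesz)
    have hmeas1 : AEStronglyMeasurable (fun x => u₀ x - radialCutoff R₀ (2 * R₀) x • P x) volume :=
      (hu₀s.continuous.sub ((radialCutoff_contDiff R₀ (2 * R₀) (n := 0)).continuous.smul hPs.continuous)).aestronglyMeasurable
    have hgπc : Continuous gπ := (contDiff_gradient_of_contDiff_top (contDiff_divPotential hG hGc)).continuous
    have hmeas2 : AEStronglyMeasurable (fun x => radialCutoff R₀ (2 * R₀) x • gπ x) volume :=
      ((radialCutoff_contDiff R₀ (2 * R₀) (n := 0)).continuous.smul hgπc).aestronglyMeasurable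
    have hcorr : eLpNorm (fun x => u₀ x - radialCutoff R₀ (2 * R₀) x • P x) 3 volume ≤
        ENNReal.ofReal (CS * D) * volume (Metric.closedBall (0 : EuclideanSpace ℝ (Fin 3)) (2 * R₀)) ^ (1 / (3 : ℝ)) :=
      eLpNorm_three_le_of_bound_of_support hu₀near hu₀corr
    have hgrad : eLpNorm (fun x => radialCutoff R₀ (2 * R₀) x • gπ x) 3 volume ≤
        CR * eLpNorm ((Metric.ball (0 : EuclideanSpace ℝ (Fin 3)) (r + L)).indicator a) 3 volume := by
      refine le_trans (eLpNorm_mono fun x => ?_) (hR a r L ha hr0.le hL0).2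
      rw [norm_smul, Real.norm_eq_abs, abs_of_nonneg (radialCutoff_nonneg _ _ _)]
      exact mul_le_of_le_one_left (norm_nonneg _) (radialCutoff_le_one _ _ _)
    -- the volume factor: `|B̄(0,2R₀)|^{1/3} = 2R₀·|B̄(0,1)|^{1/3}` and `CS·D·2R₀·v₁ ≤ 2CS·Cfar·v₁·η`
    have hvol : volume (Metric.closedBall (0 : EuclideanSpace ℝ (Fin 3)) (2 * R₀)) ^ (1 / (3 : ℝ)) =
        ENNReal.ofReal (2 * R₀) * V₁ ^ (1 / (3 : ℝ)) := by
      rw [Measure.addHaar_closedBall _ _ (by positivity : (0 : ℝ) ≤ 2 * R₀), finrank_euclideanSpace_fin,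
        ENNReal.mul_rpow_of_nonneg _ _ (by norm_num), hV₁]
      congr 1
      rw [ENNReal.ofReal_rpow_of_nonneg (by positivity) (by norm_num), ← Real.rpow_natCast,
        ← Real.rpow_mul (by positivity)]
      norm_num
    have hcorr' : eLpNorm (fun x => u₀ x - radialCutoff R₀ (2 * R₀) x • P x) 3 volume ≤
        ENNReal.ofReal ((Clog + CS * Cfar * (1 + 2 * v₁)) * η) := by
      refine hcorr.trans ?_
      rw [hvol, ← mul_assoc, ← ENNReal.ofReal_mul (by positivity)]
      have hV : V₁ ^ (1 / (3 : ℝ)) = ENNReal.ofReal v₁ := by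
        rw [hv₁, ENNReal.ofReal_toReal (ENNReal.rpow_ne_top_of_nonneg (by norm_num) hV₁top)]
      rw [hV, ← ENNReal.ofReal_mul (by positivity)]
      refine ENNReal.ofReal_le_ofReal ?_
      have h1 : CS * D * (2 * R₀) ≤ 2 * CS * Cfar * η := by
        rw [hD]
        have hRR : (r + L) ^ 2 / R₀ ^ 2 * R₀ = (r + L) ^ 2 / R₀ := by
          field_simp
        have h2 : (r + L) ^ 2 / R₀ ≤ 1 := by
          rw [div_le_one hR₀pos, hR₀]; nlinarith
        calc CS * (Cfar * η * (r + L) ^ 2 / R₀ ^ 2) * (2 * R₀) = 2 * CS * Cfar * η * ((r + L) ^ 2 / R₀ ^ 2 * R₀) := by ring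
          _ = 2 * CS * Cfar * η * ((r + L) ^ 2 / R₀) := by rw [hRR]
          _ ≤ 2 * CS * Cfar * η * 1 := mul_le_mul_of_nonneg_left h2 (by positivity)
          _ = 2 * CS * Cfar * η := mul_one _
      calc CS * D * (2 * R₀) * v₁ ≤ 2 * CS * Cfar * η * v₁ := mul_le_mul_of_nonneg_right h1 hv₁0
        _ ≤ (Clog + CS * Cfar * (1 + 2 * v₁)) * η := by
            have : 0 ≤ (Clog + CS * Cfar) * η := by positivity
            nlinarith
    have hfun : (fun x => u₀ x - χ x • a x) =
        (fun x => u₀ x - radialCutoff R₀ (2 * R₀) x • P x) - fun x => radialCutoff R₀ (2 * R₀) x • gπ x := by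
      funext x; simp only [Pi.sub_apply]; exact hdiff x
    rw [hfun]
    calc eLpNorm ((fun x => u₀ x - radialCutoff R₀ (2 * R₀) x • P x) - fun x => radialCutoff R₀ (2 * R₀) x • gπ x) 3 volume
        ≤ eLpNorm (fun x => u₀ x - radialCutoff R₀ (2 * R₀) x • P x) 3 volume +
            eLpNorm (fun x => radialCutoff R₀ (2 * R₀) x • gπ x) 3 volume := eLpNorm_sub_le hmeas1 hmeas2 (by norm_num)
      _ ≤ ENNReal.ofReal ((Clog + CS * Cfar * (1 + 2 * v₁)) * η) +
            CR * eLpNorm ((Metric.ball (0 : EuclideanSpace ℝ (Fin 3)) (r + L)).indicator a) 3 volume := add_le_add hcorr' hgrad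
      _ = _ := add_comm _ _

end Summit.NavierStokesRegularity.NavierStokesRegularity.Cruxes.TypeIQuantSubcubicExp.QuietCollar

end
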